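import Mathlib
import HarnessLib

/-!
# AffBells34 — the RESTRICTION-SEPARATION lemma for NV-b: local facts (planner qa-qnc0-p1 g34, ROUND-33 §D.15)

AUTHORED AND PROVED BY THE PLANNER SEAT qa-qnc0-p1 g34 (`HOME/qa-qnc0-p1/exp34/RS34.lean`, farm rc 0 / 0 sorry); landed VERBATIM (four one-line docstrings
added, `push_neg` → `push Not`) by qn-prover-3 g19 (port ask of ROUND-33 §E′ / ROUND-34 §9; route DWalkThree, crux stmt-QuantumAdvantage-22907).

RS (informal; port = ask P-37k).  In the coin-level normal form `π = Σ_{g ∈ Surv} [ℓ_g(u) ≢ r_g]` on the parity coset of `{0,1}^Z`, suppose the wide row `b`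
has coins `i, j, k ∈ supp ℓ_b` such that every OTHER surviving row has at most one non-zero coefficient among `{i,j,k}`, and two further coins `l, l'`
with non-zero `b`-coefficients.  Fix all coins except `i, j, k`; the coset condition makes `u_k = u_i ⊕ u_j ⊕ odd`, a 2-dimensional slice.  On the slice
every other row's test is an AFFINE function of `(u_i, u_j)` (it depends on at most one of `u_i, u_j, u_k`), while `b`'s test `[α u_i + β u_j + γ u_k ≡ r]`
is affine iff its 4-point count is even — and for each `(α, β, γ) ∈ {1,2}^3` and each slice type exactly ONE residue `r` is bad (`rs_atMostOneBad`);
the values of `u_l, u_{l'}` move `(r, type)` over a set containing two distinct residues of one type (`D.15`), so some slice makes `π|slice` non-affine,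
hence `π ≢ 0`.  Consequence: NV-b holds whenever `Σ_{g ∈ Surv∖b} |supp ℓ_g ∩ supp ℓ_b|² < |supp ℓ_b|²/2` (a shadow-free triangle exists by Turán).
-/

namespace Summit.QuantumAdvantage.AdviceFreeQNC0

namespace AffBells34

open Finset

/-- number of points of the slice `{(u_i,u_j)}` (with `u_k = u_i ⊕ u_j ⊕ odd`) where `α u_i + β u_j + γ u_k = r`. -/
def rsCount (α β γ r : ZMod 3) (odd : Bool) : ℕ :=
  ((univ : Finset (Bool × Bool)).filter fun p =>
    α * (if p.1 then 1 else 0) + β * (if p.2 then 1 else 0) + γ * (if ((p.1 ^^ p.2) ^^ odd) then 1 else 0) = r).card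

/-- A Boolean function on `{0,1}²` is affine over `𝔽₂` iff its number of `true` points is even. -/
theorem affine_iff_even (f : Bool × Bool → Bool) :
    (∃ a b c : Bool, ∀ p : Bool × Bool, f p = ((a ^^ (b && p.1)) ^^ (c && p.2))) ↔ Even ((univ.filter fun p => f p = true).card) := by
  revert f; decide

/-- **RS local fact**: for non-zero coefficients, among any two distinct residues at least one gives an ODD count (a non-affine slice function). -/
theorem rs_atMostOneBad : ∀ α β γ : ZMod 3, α ≠ 0 → β ≠ 0 → γ ≠ 0 → ∀ odd : Bool, ∀ r r' : ZMod 3, r ≠ r' →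
    Odd (rsCount α β γ r odd) ∨ Odd (rsCount α β γ r' odd) := by
  decide

/-- single-overlap tests are affine on the slice: a test reading only `u_k = u_i ⊕ u_j ⊕ odd` (coefficient `γ`, residue `r`) has an even… no — it is a
function of ONE bit, hence affine; recorded as: every `f` that factors through `u_i ⊕ u_j` is affine. -/
theorem xor_reader_affine (h : Bool → Bool) (odd : Bool) :
    ∃ a b c : Bool, ∀ p : Bool × Bool, h ((p.1 ^^ p.2) ^^ odd) = ((a ^^ (b && p.1)) ^^ (c && p.2)) := by
  revert h odd; decide

/-- a test reading only `u_i` is affine on the slice. -/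
theorem fst_reader_affine (h : Bool → Bool) : ∃ a b c : Bool, ∀ p : Bool × Bool, h p.1 = ((a ^^ (b && p.1)) ^^ (c && p.2)) := by
  revert h; decide

/-- a test reading only `u_j` is affine on the slice. -/
theorem snd_reader_affine (h : Bool → Bool) : ∃ a b c : Bool, ∀ p : Bool × Bool, h p.2 = ((a ^^ (b && p.1)) ^^ (c && p.2)) := by
  revert h; decide

/-- affine functions are closed under pointwise xor (so a sum of single-overlap tests stays affine, and adding ONE non-affine test makes the slice
function non-affine, in particular not identically `false`). -/
theorem affine_xor {f g : Bool × Bool → Bool}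
    (hf : ∃ a b c : Bool, ∀ p, f p = ((a ^^ (b && p.1)) ^^ (c && p.2)))
    (hg : ∃ a b c : Bool, ∀ p, g p = ((a ^^ (b && p.1)) ^^ (c && p.2))) :
    ∃ a b c : Bool, ∀ p, (f p ^^ g p) = ((a ^^ (b && p.1)) ^^ (c && p.2)) := by
  obtain ⟨a, b, c, hf⟩ := hf
  obtain ⟨a', b', c', hg⟩ := hg
  refine ⟨a ^^ a', b ^^ b', c ^^ c', fun p => ?_⟩
  rw [hf p, hg p]
  cases a <;> cases b <;> cases c <;> cases a' <;> cases b' <;> cases c' <;> cases p.1 <;> cases p.2 <;> rfl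

/-- a function with an odd number of ones on the 4-point slice is not affine. -/
theorem not_affine_of_odd {f : Bool × Bool → Bool} (h : Odd ((univ.filter fun p => f p = true).card)) :
    ¬ ∃ a b c : Bool, ∀ p : Bool × Bool, f p = ((a ^^ (b && p.1)) ^^ (c && p.2)) := by
  rw [affine_iff_even]
  exact Nat.not_even_iff_odd.mpr h

/-- a non-affine function on the slice takes the value `true`. -/
theorem exists_true_of_not_affine {f : Bool × Bool → Bool}
    (h : ¬ ∃ a b c : Bool, ∀ p : Bool × Bool, f p = ((a ^^ (b && p.1)) ^^ (c && p.2))) : ∃ p, f p = true := by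
  by_contra hne
  push Not at hne
  exact h ⟨false, false, false, fun p => by simpa using hne p⟩

end AffBells34

end Summit.QuantumAdvantage.AdviceFreeQNC0
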